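import Literature.RepresentationTheory.Ichino2022.FockKTypeCorrespondence

/-!
# Ichino (2022) Lemma 7.10 in the explicit Fock model `ℂ[z₁, z₂, z₃]` of the COMPACT pair `(U(1), U(3))` — the model

Companion of `Literature.RepresentationTheory.Ichino2022.ExplicitLineModel` (the pair `(U(1), U(2,1))`) for the
DEFINITE signatures `(p,q;r,s) = (1,0;3,0)` (positive line) and `(0,1;3,0)` (negative line).  Here both groups are
compact, `𝔭′ = 0`, the space of joint harmonics is the whole Fock model `ℂ[z₁,z₂,z₃]` ([Ad07] J. Adams, *The theta
correspondence over ℝ* (2007) §4), and the `K × K′ = U(1) × U(3)`-types are read off from joint highest-weight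
vectors:

* positive line (`§1`): `U(1)` acts by the degree, the diagonal torus of `U(3)` by the exponents, the raising
  operators are `z_a ∂_b` (`a < b`); `isHWPos_iff` — the joint highest-weight vectors are exactly `c·z₁^a`;
* negative line (`§2`, the conjugate model): `U(1)` by minus the degree, the torus by minus the exponents, raising
  operators `z_b ∂_a` (`a < b`); `isHWNeg_iff` — exactly `c·z₃^d`.

Weights are Mathlib's `MvPolynomial.IsWeightedHomogeneous`.  The dictionaries `explicitPosLine`, `explicitNegLine :
FockHarmonics S` and the THEOREMS `lemma_7_10_explicitPosLine`, `lemma_7_10_explicitNegLine` ([Ich22] Lemma 7.10 with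
its printed vacuum shifts `(r−s)/2 + m₀/2`, `(p−q)/2 + n₀/2`) are in the companion
`Literature.RepresentationTheory.Ichino2022.ExplicitDefLineLemma`.  Companion package file (pub-hodgecm):
`HodgeCM/Model/Binders/IchinoExplicitDefLine.lean` (same mathematics over the package's `weightOp` API).

## References
* A. Ichino, Adv. Math. 398 (2022) 108188, §4.1, §7.5 Lemma 7.10. [Ichino2022ThetaReal]
* J. Adams, *The theta correspondence over ℝ* (2007), §4, Def 6.1. [Adams2007Theta]
-/

noncomputable section

namespace Literature.RepresentationTheory.Ichino2022

namespace ExplicitDefLine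

open MvPolynomial Finsupp
open FockHarmonics HarmonicParam

/-! ## §0 The model `ℂ[z₁,z₂,z₃]` and its weights -/

/-- The explicit Fock model `ℂ[z₁,z₂,z₃]` of `(U(1), U(3))`. [cite: Adams2007Theta, §4] -/
abbrev DefModel : Type := MvPolynomial (Fin 3) ℂ

/-- Weights of the diagonal torus of `U(3)`: `z_a ↦ e_a`. [cite: Ichino2022ThetaReal, §7.5 Lemma 7.10] -/
def defTorWt (a : Fin 3) : Fin 3 → ℤ := fun a' => if a' = a then 1 else 0


/-- [folklore] -/
theorem weight_defTorWt (a : Fin 3) (m : Fin 3 →₀ ℕ) : weight (defTorWt a) m = (m a : ℤ) := by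
  rw [weight_apply, Finsupp.sum_fintype _ _ (by simp)]
  simp only [defTorWt, Fin.sum_univ_three]
  fin_cases a <;> simp

/-- total degree weight (`U(W) = U(1)` on a positive line: every `z_a ↦ u^{+1}`). [cite: Ichino2022ThetaReal, §7.5 Lemma 7.10] -/
def degWt : Fin 3 → ℤ := fun _ => 1

/-- [folklore] -/
theorem weight_degWt (m : Fin 3 →₀ ℕ) : weight degWt m = (m 0 : ℤ) + m 1 + m 2 := by
  rw [weight_apply, Finsupp.sum_fintype _ _ (by simp)]
  simp only [degWt, Fin.sum_univ_three]; ring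

/-- The exponent vector `(n₀, n₁, n₂)`. [folklore] -/
noncomputable def expo3 (n₀ n₁ n₂ : ℕ) : Fin 3 →₀ ℕ := single 0 n₀ + single 1 n₁ + single 2 n₂

/-- [folklore] -/
@[simp] theorem expo3_zero (n₀ n₁ n₂ : ℕ) : expo3 n₀ n₁ n₂ 0 = n₀ := by simp [expo3]
/-- [folklore] -/
@[simp] theorem expo3_one (n₀ n₁ n₂ : ℕ) : expo3 n₀ n₁ n₂ 1 = n₁ := by simp [expo3]
/-- [folklore] -/
@[simp] theorem expo3_two (n₀ n₁ n₂ : ℕ) : expo3 n₀ n₁ n₂ 2 = n₂ := by simp [expo3]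

/-- [folklore] -/
theorem fin3_ext {m m' : Fin 3 →₀ ℕ} (h0 : m 0 = m' 0) (h1 : m 1 = m' 1) (h2 : m 2 = m' 2) : m = m' := by
  ext ⟨i, hi⟩
  interval_cases i
  · exact h0
  · exact h1
  · exact h2

/-- [folklore] -/
theorem X_pow_eq_expo3_zero (a : ℕ) : (X 0 : DefModel) ^ a = monomial (expo3 a 0 0) 1 := by
  rw [X_pow_eq_monomial, expo3]; simp

/-- [folklore] -/
theorem X_pow_eq_expo3_two (d : ℕ) : (X 2 : DefModel) ^ d = monomial (expo3 0 0 d) 1 := by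
  rw [X_pow_eq_monomial, expo3]; simp

/-- A joint torus weight vector with weights `(n₀,n₁,n₂)` is a multiple of the monomial `z^{(n₀,n₁,n₂)}`. [folklore] -/
theorem eq_smul_monomial_of_torus {f : DefModel} {n₀ n₁ n₂ : ℤ}
    (h0 : IsWeightedHomogeneous (defTorWt 0) f n₀) (h1 : IsWeightedHomogeneous (defTorWt 1) f n₁)
    (h2 : IsWeightedHomogeneous (defTorWt 2) f n₂) (hf : f ≠ 0) :
    0 ≤ n₀ ∧ 0 ≤ n₁ ∧ 0 ≤ n₂ ∧
      f = coeff (expo3 n₀.toNat n₁.toNat n₂.toNat) f • monomial (expo3 n₀.toNat n₁.toNat n₂.toNat) 1 := by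
  classical
  have key : ∀ m ∈ f.support, (m 0 : ℤ) = n₀ ∧ (m 1 : ℤ) = n₁ ∧ (m 2 : ℤ) = n₂ := by
    intro m hm
    have hc := MvPolynomial.mem_support_iff.mp hm
    refine ⟨?_, ?_, ?_⟩
    · have := h0 hc; rwa [weight_defTorWt] at this
    · have := h1 hc; rwa [weight_defTorWt] at this
    · have := h2 hc; rwa [weight_defTorWt] at this
  obtain ⟨m₀, hm₀⟩ : ∃ m, m ∈ f.support := by
    by_contra hno
    apply hf
    ext m
    rw [coeff_zero]
    by_contra hne
    exact hno ⟨m, MvPolynomial.mem_support_iff.mpr hne⟩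
  obtain ⟨k0, k1, k2⟩ := key m₀ hm₀
  refine ⟨by omega, by omega, by omega, ?_⟩
  have hM : ∀ m ∈ f.support, m = expo3 n₀.toNat n₁.toNat n₂.toNat := by
    intro m hm
    obtain ⟨j0, j1, j2⟩ := key m hm
    refine fin3_ext ?_ ?_ ?_
    · rw [expo3_zero]; omega
    · rw [expo3_one]; omega
    · rw [expo3_two]; omega
  ext m
  rw [coeff_smul, coeff_monomial, smul_eq_mul]
  by_cases hm : expo3 n₀.toNat n₁.toNat n₂.toNat = m
  · rw [if_pos hm, mul_one, hm]
  · rw [if_neg hm, mul_zero]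
    by_contra hne
    exact hm (hM m (MvPolynomial.mem_support_iff.mpr hne)).symm

/-- `z_a ∂_b` on a monomial vanishes iff `z_b` does not occur (`c ≠ 0`). [folklore] -/
theorem X_mul_pderiv_monomial_eq_zero_iff (a b : Fin 3) (m : Fin 3 →₀ ℕ) (c : ℂ) (hc : c ≠ 0) :
    (X a : DefModel) * pderiv b (monomial m c) = 0 ↔ m b = 0 := by
  classical
  rw [mul_eq_zero, pderiv_monomial]
  constructor
  · rintro (h | h)
    · exact absurd h (X_ne_zero _)
    · rw [monomial_eq_zero] at h
      rcases mul_eq_zero.mp h with h' | h'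
      · exact absurd h' hc
      · exact_mod_cast h'
  · intro h
    right
    rw [h]; simp

/-! ## §1 The positive line: `ℂ[z₁,z₂,z₃]` with the standard `U(3)` and `U(1)` by the degree -/

/-- **Joint `U(1) × U(3)`-highest-weight vector of the POSITIVE-line model**: non-zero, `U(1)`-weight `k` (the degree),
`U(3)`-torus weights `(t₀,t₁,t₂)`, killed by the three raising operators `z_a ∂_b` (`a < b`).  (Every vector is
harmonic: `𝔭′ = 0` for the compact `U(3)`.) [cite: Adams2007Theta, §4] -/
structure IsHWPos (f : DefModel) (k t₀ t₁ t₂ : ℤ) : Prop where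
  /-- non-zero -/
  ne : f ≠ 0
  /-- `U(1)`-weight = degree -/
  deg : IsWeightedHomogeneous degWt f k
  /-- torus weights -/
  tor0 : IsWeightedHomogeneous (defTorWt 0) f t₀
  /-- torus weights -/
  tor1 : IsWeightedHomogeneous (defTorWt 1) f t₁
  /-- torus weights -/
  tor2 : IsWeightedHomogeneous (defTorWt 2) f t₂
  /-- killed by the raising operators -/
  e01 : (X 0 : DefModel) * pderiv 1 f = 0
  /-- killed by the raising operators -/
  e02 : (X 0 : DefModel) * pderiv 2 f = 0
  /-- killed by the raising operators -/
  e12 : (X 1 : DefModel) * pderiv 2 f = 0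

/-- **Classification, positive line**: the joint highest-weight vectors are exactly `c·z₁^a`, `a ≥ 0`, with degree `a`
and torus weights `(a,0,0)` — the `U(3)`-types `Sym^a` ([Ich22] L7.10 at `(1,0;3,0)`: `μ′ = (a,0,0) + shift`).
[cite: Ichino2022ThetaReal, §7.5 Lemma 7.10] -/
theorem isHWPos_iff (f : DefModel) (k t₀ t₁ t₂ : ℤ) :
    IsHWPos f k t₀ t₁ t₂ ↔
      ∃ (a : ℕ) (c : ℂ), c ≠ 0 ∧ f = c • (X 0 : DefModel) ^ a ∧ k = a ∧ t₀ = a ∧ t₁ = 0 ∧ t₂ = 0 := by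
  classical
  constructor
  · intro H
    obtain ⟨ht₀, ht₁, ht₂, hf⟩ := eq_smul_monomial_of_torus H.tor0 H.tor1 H.tor2 H.ne
    set c := coeff (expo3 t₀.toNat t₁.toNat t₂.toNat) f with hc_def
    have hc : c ≠ 0 := by
      intro h0; apply H.ne; rw [hf, h0, zero_smul]
    have hfm : f = monomial (expo3 t₀.toNat t₁.toNat t₂.toNat) c := by
      rw [hf, smul_monomial, smul_eq_mul, mul_one]
    have h1 : t₁.toNat = 0 := by
      have h := H.e01
      rw [hfm, X_mul_pderiv_monomial_eq_zero_iff _ _ _ _ hc] at h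
      simpa using h
    have h2 : t₂.toNat = 0 := by
      have h := H.e02
      rw [hfm, X_mul_pderiv_monomial_eq_zero_iff _ _ _ _ hc] at h
      simpa using h
    have hk : k = t₀ + t₁ + t₂ := by
      have h := H.deg
      rw [hfm] at h
      have hcoeff : coeff (expo3 t₀.toNat t₁.toNat t₂.toNat)
          (monomial (expo3 t₀.toNat t₁.toNat t₂.toNat) c : DefModel) ≠ 0 := by
        rwa [coeff_monomial, if_pos rfl]
      have h' := h hcoeff
      rw [weight_degWt, expo3_zero, expo3_one, expo3_two] at h'
      omega
    refine ⟨t₀.toNat, c, hc, ?_, by omega, by omega, by omega, by omega⟩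
    rw [hfm, X_pow_eq_expo3_zero, smul_monomial, smul_eq_mul, mul_one, h1, h2]
  · rintro ⟨a, c, hc, rfl, rfl, rfl, rfl, rfl⟩
    have hm : c • (X 0 : DefModel) ^ a = monomial (expo3 a 0 0) c := by
      rw [X_pow_eq_expo3_zero, smul_monomial, smul_eq_mul, mul_one]
    refine ⟨?_, ?_, ?_, ?_, ?_, ?_, ?_, ?_⟩
    · rw [hm, Ne, monomial_eq_zero]; exact hc
    · rw [hm]; exact isWeightedHomogeneous_monomial _ _ _ (by rw [weight_degWt]; simp)
    · rw [hm]; exact isWeightedHomogeneous_monomial _ _ _ (by rw [weight_defTorWt]; simp)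
    · rw [hm]; exact isWeightedHomogeneous_monomial _ _ _ (by rw [weight_defTorWt]; simp)
    · rw [hm]; exact isWeightedHomogeneous_monomial _ _ _ (by rw [weight_defTorWt]; simp)
    · rw [hm, X_mul_pderiv_monomial_eq_zero_iff _ _ _ _ hc]; simp
    · rw [hm, X_mul_pderiv_monomial_eq_zero_iff _ _ _ _ hc]; simp
    · rw [hm, X_mul_pderiv_monomial_eq_zero_iff _ _ _ _ hc]; simp

/-! ## §2 The negative line: the conjugate model (dual `U(3)`-action, `U(1)` by minus the degree) -/

/-- **Joint highest-weight vector of the NEGATIVE-line (conjugate) model**: `U(1)`-weight `k` with the degree acting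
by `−1` (so `k = −deg`), `U(3)`-torus weights `(t₀,t₁,t₂)` = MINUS the exponents, killed by the raising operators of
the DUAL representation, which are `−z_b ∂_a` (`a < b`) on the dual coordinates. [cite: Adams2007Theta, §4] -/
structure IsHWNeg (f : DefModel) (k t₀ t₁ t₂ : ℤ) : Prop where
  /-- non-zero -/
  ne : f ≠ 0
  /-- `U(1)`-weight `k` = minus the degree -/
  deg : IsWeightedHomogeneous degWt f (-k)
  /-- torus weights = minus the exponents -/
  tor0 : IsWeightedHomogeneous (defTorWt 0) f (-t₀)
  /-- torus weights -/
  tor1 : IsWeightedHomogeneous (defTorWt 1) f (-t₁)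
  /-- torus weights -/
  tor2 : IsWeightedHomogeneous (defTorWt 2) f (-t₂)
  /-- killed by the dual raising operators -/
  e01 : (X 1 : DefModel) * pderiv 0 f = 0
  /-- killed by the dual raising operators -/
  e02 : (X 2 : DefModel) * pderiv 0 f = 0
  /-- killed by the dual raising operators -/
  e12 : (X 2 : DefModel) * pderiv 1 f = 0

/-- **Classification, negative line**: the joint highest-weight vectors are exactly `c·z₃^d`, `d ≥ 0`, with
`U(1)`-weight `−d` and torus weights `(0,0,−d)` ([Ich22] L7.10 at `(0,1;3,0)`: `μ′ = (0,0,d′) + shift`, `d′ ≤ 0`).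
[cite: Ichino2022ThetaReal, §7.5 Lemma 7.10] -/
theorem isHWNeg_iff (f : DefModel) (k t₀ t₁ t₂ : ℤ) :
    IsHWNeg f k t₀ t₁ t₂ ↔
      ∃ (d : ℕ) (c : ℂ), c ≠ 0 ∧ f = c • (X 2 : DefModel) ^ d ∧ k = -(d : ℤ) ∧ t₀ = 0 ∧ t₁ = 0 ∧ t₂ = -(d : ℤ) := by
  classical
  constructor
  · intro H
    obtain ⟨ht₀, ht₁, ht₂, hf⟩ := eq_smul_monomial_of_torus H.tor0 H.tor1 H.tor2 H.ne
    set c := coeff (expo3 (-t₀).toNat (-t₁).toNat (-t₂).toNat) f with hc_def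
    have hc : c ≠ 0 := by
      intro h0; apply H.ne; rw [hf, h0, zero_smul]
    have hfm : f = monomial (expo3 (-t₀).toNat (-t₁).toNat (-t₂).toNat) c := by
      rw [hf, smul_monomial, smul_eq_mul, mul_one]
    have h0 : (-t₀).toNat = 0 := by
      have h := H.e01
      rw [hfm, X_mul_pderiv_monomial_eq_zero_iff _ _ _ _ hc] at h
      simpa using h
    have h1 : (-t₁).toNat = 0 := by
      have h := H.e12
      rw [hfm, X_mul_pderiv_monomial_eq_zero_iff _ _ _ _ hc] at h
      simpa using h
    have hk : -k = -t₀ + -t₁ + -t₂ := by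
      have h := H.deg
      rw [hfm] at h
      have hcoeff : coeff (expo3 (-t₀).toNat (-t₁).toNat (-t₂).toNat)
          (monomial (expo3 (-t₀).toNat (-t₁).toNat (-t₂).toNat) c : DefModel) ≠ 0 := by
        rwa [coeff_monomial, if_pos rfl]
      have h' := h hcoeff
      rw [weight_degWt, expo3_zero, expo3_one, expo3_two] at h'
      omega
    refine ⟨(-t₂).toNat, c, hc, ?_, by omega, by omega, by omega, by omega⟩
    rw [hfm, X_pow_eq_expo3_two, smul_monomial, smul_eq_mul, mul_one, h0, h1]
  · rintro ⟨d, c, hc, rfl, rfl, rfl, rfl, rfl⟩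
    have hm : c • (X 2 : DefModel) ^ d = monomial (expo3 0 0 d) c := by
      rw [X_pow_eq_expo3_two, smul_monomial, smul_eq_mul, mul_one]
    refine ⟨?_, ?_, ?_, ?_, ?_, ?_, ?_, ?_⟩
    · rw [hm, Ne, monomial_eq_zero]; exact hc
    · rw [hm]; exact isWeightedHomogeneous_monomial _ _ _ (by rw [weight_degWt]; simp)
    · rw [hm]; exact isWeightedHomogeneous_monomial _ _ _ (by rw [weight_defTorWt]; simp)
    · rw [hm]; exact isWeightedHomogeneous_monomial _ _ _ (by rw [weight_defTorWt]; simp)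
    · rw [hm]; exact isWeightedHomogeneous_monomial _ _ _ (by rw [weight_defTorWt]; simp)
    · rw [hm, X_mul_pderiv_monomial_eq_zero_iff _ _ _ _ hc]; simp
    · rw [hm, X_mul_pderiv_monomial_eq_zero_iff _ _ _ _ hc]; simp
    · rw [hm, X_mul_pderiv_monomial_eq_zero_iff _ _ _ _ hc]; simp

end ExplicitDefLine

end Literature.RepresentationTheory.Ichino2022
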